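import Mathlib
import Literature.NumberTheory.Transcendental.LinEDS
import Literature.NumberTheory.Transcendental.LinEDSCode
import Literature.NumberTheory.Transcendental.MZVShuffleRegularisation
import Summits.KontsevichZagierPeriods.KontsevichZagierPeriods.Theorems.FurushoPentagonKernelModuloPeriodConjectureRowBitsParity
import Summits.KontsevichZagierPeriods.KontsevichZagierPeriods.Theorems.FurushoPentagonKernelModuloPeriodConjectureElimLoopSound
import Summits.KontsevichZagierPeriods.KontsevichZagierPeriods.Theorems.FurushoPentagonKernelModuloPeriodConjectureOddDetAndSolve
import Summits.KontsevichZagierPeriods.KontsevichZagierPeriods.Theorems.FurushoPentagonKernelModuloPeriodConjectureLeafLowWeight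
import HarnessLib

/-!
# `KernelModuloPeriodConjecture`, line `Sketch`: the master soundness theorem of the engine

Crux `FurushoPentagon.KernelModuloPeriodConjecture` (stmt-KontsevichZagierPeriods-15058), line
`Sketch`, registered stub `stub_leaf_of_check` of the lead's skeleton v11: a successful run of
the kernel-checkable GF(2) rank engine `LinEDS.check k names`
(`Literature/NumberTheory/Transcendental/LinEDS.lean`) proves the weight-`k` slice of the algebraic
leaf `AssociatorHoffmanSpanning`: every admissible index `s` of weight `k` has ONE finitely
supported Hoffman expansion `c_{bw s}(φ) = Σ_t b_t c_{bw t}(φ)` valid at every group-like solution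
`φ` of Drinfeld's pentagon over every commutative `ℚ`-algebra. Assembly of the soundness chain:
E6 `stub_elimLoop_sound` (pivots in every column are XOR-combinations of the rows), E9
`stub_rowBits_parity` (row bits = parities of the integer relation matrix, folded rows supported
on admissible words), E7 `stub_oddDet_and_solve` (⇒ odd determinant ⇒ every column word's
coefficient is a FIXED rational combination of the integer rows), E5 `stub_eval_rowZ_divFold`
(the integer rows and their folds vanish at every pentagon solution), E8 `stub_cols_spec`
(admissible non-column words are Hoffman).

References: K. Ihara, M. Kaneko, D. Zagier, Compos. Math. 142 (2006) §2, Conjecture 1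
[IharaKanekoZagier2006]; H. Furusho, Ann. of Math. 174 (2011) Thm 1.2 [Furusho2011]; F. Brown,
Ann. of Math. 175 (2012) Thm 1.1 [Brown2012].
-/

namespace Summit.KontsevichZagierPeriods.FurushoPentagon.KernelModuloPeriodConjecture

open Literature.NumberTheory.Transcendental
open Literature.NumberTheory.Transcendental.LinEDS

/-! ### Small facts -/

/-- The code of the binary word of a nonempty admissible index is an admissible code: below
`2^(weight-1)` and odd. [folklore] -/
theorem masterE10_code_binaryWord {s : List ℕ} (hs : MZV.IsAdmissible s) (hs0 : s ≠ []) :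
    LinEDS.code (MZV.binaryWord s) < 2 ^ (MZV.weight s - 1) ∧
      LinEDS.code (MZV.binaryWord s) % 2 = 1 := by
  obtain ⟨a, s', rfl⟩ := List.exists_cons_of_ne_nil hs0
  have ha : 2 ≤ a := hs.2 (List.cons_ne_nil _ _)
  have hlen := MZV.length_binaryWord hs.1
  have hhead := MZV.head?_binaryWord (s := s') ha
  have hlast := MZV.getLast?_binaryWord (List.cons_ne_nil a s')
  set w := MZV.binaryWord (a :: s') with hw
  constructor
  · rw [List.eq_cons_of_mem_head? hhead, code_cons]
    simp only [Bool.toNat_false, zero_mul, zero_add]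
    have := code_lt w.tail
    rwa [List.length_tail, hlen] at this
  · have h0 : (LinEDS.code w).testBit 0 = true := by
      rw [testBit_code]
      obtain ⟨w', hw'⟩ := List.getLast?_eq_some_iff.mp hlast
      rw [hw']; simp
    simpa using h0

/-- Finsupp sums of finset sums of singles with distinct keys, against an additive pairing.
[folklore] -/
theorem masterE10_sum_finset_single {M : Type*} [AddCommMonoid M] (T : Finset (List ℕ))
    (c : List ℕ → ℚ) (g : List ℕ → ℚ → M) (h0 : ∀ t, g t 0 = 0)
    (hadd : ∀ t a b, g t (a + b) = g t a + g t b) :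
    (∑ t ∈ T, Finsupp.single t (c t)).sum g = ∑ t ∈ T, g t (c t) := by
  classical
  induction T using Finset.induction_on with
  | empty => simp
  | insert t T ht ih =>
    rw [Finset.sum_insert ht, Finset.sum_insert ht, Finsupp.sum_add_index' h0 hadd,
      Finsupp.sum_single_index (h0 t), ih]

/-! ### The master theorem -/

/-- **Master soundness theorem of the engine** (registered stub `stub_leaf_of_check` of the
lead's skeleton v11, crux stmt-KontsevichZagierPeriods-15058, line `Sketch`): a successful
`LinEDS.check k names` proves the weight-`k` slice of the algebraic leaf — every admissible `s` of
weight `k` has ONE Hoffman expansion valid at every group-like pentagon solution over every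
(reduced) commutative `ℚ`-algebra. [cite: IharaKanekoZagier2006, Conjecture 1] -/
theorem stub_leaf_of_check :
    ∀ (k : ℕ) (names : List (List ℕ × List ℕ)), LinEDS.check k names = true →
      ∀ s : List ℕ, MZV.IsAdmissible s → MZV.weight s = k →
        ∃ b : List ℕ →₀ ℚ, (∀ t ∈ b.support, MZV.IsHoffman t ∧ MZV.weight t = MZV.weight s) ∧ ∀ (R : Type) [CommRing R] [Algebra ℚ R] [IsReduced R] (φ : NCSeries Bool R), NCSeries.IsGroupLike φ → NCSeries.DrinfeldPentagon φ → φ (MZV.binaryWord s) = b.sum (fun t q => q • φ (MZV.binaryWord t)) := by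
  classical
  intro k names hcheck s hs hw
  by_cases hH : MZV.IsHoffman s
  · exact leafLowWeight_of_isHoffman hH
  have hs0 : s ≠ [] := by rintro rfl; exact hH fun i hi => by simp at hi
  obtain ⟨a, s', rfl⟩ := List.exists_cons_of_ne_nil hs0
  have ha : 2 ≤ a := hs.2 (List.cons_ne_nil _ _)
  have hk2 : 2 ≤ k := by rw [← hw, MZV.weight, List.sum_cons]; omega
  -- unpack the check
  simp only [LinEDS.check, Bool.and_eq_true, List.all_eq_true] at hcheck
  obtain ⟨⟨hlen, hall⟩, helim⟩ := hcheck
  rw [sameLength_eq_true_iff] at hlen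
  rw [lengthTR_eq_length] at helim
  obtain ⟨hpw, hcols, hhof, hmask⟩ := stub_cols_spec k hk2
  -- the column of `s`
  set c₀ := LinEDS.code (MZV.binaryWord (a :: s')) with hc₀
  have hwlen : (MZV.binaryWord (a :: s')).length = k := by rw [MZV.length_binaryWord hs.1, hw]
  obtain ⟨hc₀lt, hc₀odd⟩ := masterE10_code_binaryWord hs hs0
  rw [hw] at hc₀lt
  have hk' : c₀ < 2 ^ k := lt_of_lt_of_le hc₀lt (Nat.pow_le_pow_right (by norm_num) (by omega))
  have hwc₀ : LinEDS.wordOfCode k c₀ = MZV.binaryWord (a :: s') := by rw [hc₀, ← hwlen, wordOfCode_code]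
  have hc₀col : c₀ ∈ LinEDS.cols k := by
    refine (hcols c₀).mpr ⟨hc₀lt, hc₀odd, ?_⟩
    rintro ⟨t, ht, htw⟩
    rw [hwc₀] at htw
    have hpos : ∀ i ∈ t, 1 ≤ i := fun i hi => by rcases ht i hi with rfl | rfl <;> omega
    have := congrArg MZV.ofBinaryWord htw
    rw [MZV.ofBinaryWord_binaryWord hpos, MZV.ofBinaryWord_binaryWord hs.1] at this
    subst this
    exact hH ht
  -- sizes
  set n := names.length with hn
  set rows := names.map (LinEDS.rowBits k) with hrows
  have hrowslen : rows.length = n := by rw [hrows, List.length_map]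
  -- E6: pivots
  have hW : 0 < 2 ^ (k - 1) := by positivity
  have hcolmask : LinEDS.colMask k < 2 ^ 2 ^ (k - 1) := by
    refine Nat.lt_pow_two_of_testBit _ fun i hi => ?_
    cases h : (LinEDS.colMask k).testBit i
    · rfl
    · have := ((hcols i).mp ((hmask i).mp h)).1; omega
  have hrowlt : ∀ r ∈ rows, r < 2 ^ 2 ^ (k - 1) := by
    intro r hr
    obtain ⟨ν, -, rfl⟩ := List.mem_map.mp hr
    exact lt_of_le_of_lt Nat.and_le_right hcolmask
  have hpiv := stub_elimLoop_sound (2 ^ (k - 1)) rows (LinEDS.cols k) hW hrowlt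
    (fun c hc => ((hcols c).mp hc).1) (by rw [hrowslen]; exact helim)
  -- E7 (a): odd determinant
  let row : Fin n → ℕ := fun i => LinEDS.rowBits k (names.get i)
  let col : Fin n → ℕ := fun j => (LinEDS.cols k).get (Fin.cast hlen j)
  have hcolmem : ∀ j, col j ∈ LinEDS.cols k := fun j => List.get_mem _ _
  have hmono : StrictMono col := by
    intro j j' hjj'
    exact List.pairwise_iff_get.mp hpw (Fin.cast hlen j) (Fin.cast hlen j') hjj'
  have hofFn : List.ofFn row = rows := by
    rw [hrows, show row = LinEDS.rowBits k ∘ names.get from rfl, ← List.map_ofFn, List.ofFn_get]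
  let A : Matrix (Fin n) (Fin n) ℤ := fun i j => LinEDS.entry k (names.get i) (col j)
  have hvalid : ∀ i : Fin n, LinEDS.validName k (names.get i) = true :=
    fun i => hall _ (List.get_mem _ _)
  have hpar : ∀ i j, Odd (A i j) ↔ (row i).testBit (col j) = true :=
    fun i j => ((stub_rowBits_parity k (names.get i) (hvalid i)).1 (col j) (hcolmem j)).symm
  have hdet : Odd A.det :=
    stub_oddDet_and_solve.1 n row col hmono (fun j => hofFn ▸ hpiv (col j) (hcolmem j)) A hpar
  -- E7 (b): solve for the column of `s`
  obtain ⟨i₀, hi₀⟩ := List.mem_iff_get.mp hc₀col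
  set j₀ : Fin n := Fin.cast hlen.symm i₀ with hj₀
  have hcolj₀ : col j₀ = c₀ := by
    have hcast : Fin.cast hlen (Fin.cast hlen.symm i₀) = i₀ := Fin.ext rfl
    show (LinEDS.cols k).get (Fin.cast hlen (Fin.cast hlen.symm i₀)) = c₀
    rw [hcast]; exact hi₀
  obtain ⟨l, hl⟩ := stub_oddDet_and_solve.2 n A hdet j₀
  -- the folded integer rows and their coefficients
  let g : Fin n → (List Bool →₀ ℤ) := fun i => LinEDS.divFold (LinEDS.rowZ (names.get i))
  let coef : List Bool → ℚ := fun w => ∑ i, l i * (g i w : ℚ)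
  have hcoef_col : ∀ j, coef (LinEDS.wordOfCode k (col j)) = if j = j₀ then 1 else 0 := fun j => hl j
  -- the answer
  let T : Finset (List ℕ) := (LinEDS.hofLists k).toFinset
  refine ⟨∑ t ∈ T, Finsupp.single t (-coef (MZV.binaryWord t)), fun t ht => ?_,
    fun R _ _ _ φ hg h5 => ?_⟩
  · -- support
    have ht' : t ∈ T := by
      by_contra hnot
      rw [Finsupp.mem_support_iff, Finsupp.finsetSum_apply] at ht
      exact ht (Finset.sum_eq_zero fun t' ht'' => Finsupp.single_eq_of_ne fun h => hnot (h ▸ ht''))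
    obtain ⟨hH', hwt⟩ := (hhof t).mp (List.mem_toFinset.mp ht')
    exact ⟨hH', by rw [hwt, hw]⟩
  · -- the identity at a pentagon solution
    have h1 : φ [true] = 0 := h5.apply_letter_eq_zero_of_isGroupLike hg true
    -- every folded row evaluates to zero
    have hev : ∀ i, LinEDS.evalZ φ (g i) = 0 := fun i => by
      show LinEDS.evalZ φ (LinEDS.divFold (LinEDS.rowZ (names.get i))) = 0
      rw [stub_eval_rowZ_divFold.2 R φ hg h1 _ (fun w hw =>
        (stub_rowZ_support_shape k _ (hvalid i) w hw).2.1)]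
      exact stub_eval_rowZ_divFold.1 R φ hg h5 k _ (hvalid i)
    -- the common finite set of words: column words and Hoffman words
    let Wc : Finset (List Bool) := ((LinEDS.cols k).map (LinEDS.wordOfCode k)).toFinset
    let Wh : Finset (List Bool) := T.image MZV.binaryWord
    have hsupp : ∀ i, (g i).support ⊆ Wc ∪ Wh := by
      intro i w hw
      obtain ⟨hwl, hwh, hwlast⟩ := (stub_rowBits_parity k _ (hvalid i)).2.2 w hw
      have hne : w ≠ [] := by rintro rfl; simp at hwh
      -- admissible code
      have hcodelt : LinEDS.code w < 2 ^ (k - 1) := by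
        rw [List.eq_cons_of_mem_head? hwh, code_cons]
        simp only [Bool.toNat_false, zero_mul, zero_add]
        have := code_lt w.tail
        rwa [List.length_tail, hwl] at this
      have hcodeodd : LinEDS.code w % 2 = 1 := by
        have h0 : (LinEDS.code w).testBit 0 = true := by
          rw [testBit_code]
          obtain ⟨w', hw'⟩ := List.getLast?_eq_some_iff.mp hwlast
          rw [hw']; simp
        simpa using h0
      have hww : LinEDS.wordOfCode k (LinEDS.code w) = w := by rw [← hwl, wordOfCode_code]
      by_cases hcw : LinEDS.code w ∈ LinEDS.cols k
      · exact Finset.mem_union_left _ (List.mem_toFinset.mpr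
          (List.mem_map.mpr ⟨_, hcw, hww⟩))
      · have : ∃ t, MZV.IsHoffman t ∧ MZV.binaryWord t = LinEDS.wordOfCode k (LinEDS.code w) := by
          by_contra hno
          exact hcw ((hcols _).mpr ⟨hcodelt, hcodeodd, hno⟩)
        obtain ⟨t, ht, htw⟩ := this
        rw [hww] at htw
        refine Finset.mem_union_right _ (Finset.mem_image.mpr ⟨t, List.mem_toFinset.mpr ?_, htw⟩)
        refine (hhof t).mpr ⟨ht, ?_⟩
        have hpos : ∀ i ∈ t, 1 ≤ i := fun i hi => by rcases ht i hi with rfl | rfl <;> omega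
        rw [← MZV.length_binaryWord hpos, htw, hwl]
    have hdisj : Disjoint Wc Wh := by
      rw [Finset.disjoint_left]
      intro w hwc hwh
      obtain ⟨c, hc, rfl⟩ := List.mem_map.mp (List.mem_toFinset.mp hwc)
      obtain ⟨t, ht, htw⟩ := Finset.mem_image.mp hwh
      exact ((hcols c).mp hc).2.2 ⟨t, ((hhof t).mp (List.mem_toFinset.mp ht)).1, htw⟩
    -- evaluation of each folded row as a sum over the common set, with rational scalars
    have hevsum : ∀ i, LinEDS.evalZ φ (g i) = ∑ w ∈ Wc ∪ Wh, ((g i w : ℤ) : ℚ) • φ w := by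
      intro i
      unfold LinEDS.evalZ
      refine (Finsupp.sum_of_support_subset (g i) (hsupp i) (fun w n => n • φ w)
        (fun w _ => zero_smul ℤ (φ w))).trans ?_
      exact Finset.sum_congr rfl fun w _ => (Int.cast_smul_eq_zsmul ℚ _ _).symm
    -- combine with the rational coefficients `l`
    have hzero : ∑ w ∈ Wc ∪ Wh, coef w • φ w = 0 := by
      have : ∑ i, l i • LinEDS.evalZ φ (g i) = 0 := Finset.sum_eq_zero fun i _ => by
        rw [hev i, smul_zero]
      rw [← this]
      simp_rw [hevsum, Finset.smul_sum, smul_smul]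
      rw [Finset.sum_comm]
      exact Finset.sum_congr rfl fun w _ => by rw [← Finset.sum_smul]
    rw [Finset.sum_union hdisj] at hzero
    -- the column part is `φ (bw s)`
    have hcolpart : ∑ w ∈ Wc, coef w • φ w = φ (MZV.binaryWord (a :: s')) := by
      have hnd : (LinEDS.cols k).Nodup := hpw.imp fun {x y} (h : x < y) => ne_of_lt h
      have hnodup : ((LinEDS.cols k).map (LinEDS.wordOfCode k)).Nodup := by
        refine hnd.map_on fun x hx y hy hxy => ?_
        have hx' := ((hcols x).mp hx).1
        have hy' := ((hcols y).mp hy).1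
        have := congrArg LinEDS.code hxy
        rwa [code_wordOfCode (lt_of_lt_of_le hx' (Nat.pow_le_pow_right (by norm_num) (by omega))),
          code_wordOfCode (lt_of_lt_of_le hy' (Nat.pow_le_pow_right (by norm_num) (by omega)))] at this
      rw [List.sum_toFinset _ hnodup, List.map_map]
      rw [show ((LinEDS.cols k).map ((fun w => coef w • φ w) ∘ LinEDS.wordOfCode k)).sum =
          ∑ j : Fin n, coef (LinEDS.wordOfCode k (col j)) • φ (LinEDS.wordOfCode k (col j)) from ?_]
      · simp_rw [hcoef_col, ite_smul, one_smul, zero_smul, Finset.sum_ite_eq', Finset.mem_univ,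
          if_true, hcolj₀, hwc₀]
      · rw [← List.ofFn_get (l := LinEDS.cols k), List.map_ofFn, List.sum_ofFn]
        exact (Fintype.sum_equiv (finCongr hlen.symm) _ _ fun j => rfl)
    -- the Hoffman part is the `b`-sum
    have hhofpart : ∑ w ∈ Wh, coef w • φ w = ∑ t ∈ T, coef (MZV.binaryWord t) • φ (MZV.binaryWord t) := by
      refine Finset.sum_image fun t ht t' ht' h => ?_
      have hpos : ∀ i ∈ t, 1 ≤ i := fun i hi => by
        rcases ((hhof t).mp (List.mem_toFinset.mp ht)).1 i hi with rfl | rfl <;> omega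
      have hpos' : ∀ i ∈ t', 1 ≤ i := fun i hi => by
        rcases ((hhof t').mp (List.mem_toFinset.mp ht')).1 i hi with rfl | rfl <;> omega
      have := congrArg MZV.ofBinaryWord h
      rwa [MZV.ofBinaryWord_binaryWord hpos, MZV.ofBinaryWord_binaryWord hpos'] at this
    rw [hcolpart, hhofpart] at hzero
    rw [masterE10_sum_finset_single T _ (fun t q => q • φ (MZV.binaryWord t)) (fun t => zero_smul ℚ _)
      (fun t a b => add_smul a b _)]
    simp_rw [neg_smul, Finset.sum_neg_distrib]
    rw [eq_neg_iff_add_eq_zero, hzero]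

end Summit.KontsevichZagierPeriods.FurushoPentagon.KernelModuloPeriodConjecture
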